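import Literature.NumberTheory.EllipticCurves.Sprung2024.ChromaticKerGLocalBoundProofs
import Literature.NumberTheory.EllipticCurves.Sprung2024.ChromaticEulerCharAssemblyProofs
import Literature.NumberTheory.EllipticCurves.Kobayashi2003.SignedSelmerModuleFiniteProofs
import Literature.NumberTheory.EllipticCurves.Kobayashi2003.SignedSelmerRankBoundProofs
import Literature.NumberTheory.EllipticCurves.Kobayashi2003.SignedSelmerDualExistsProofs
import HarnessLib

/-!
# Kobayashi's signed Selmer group `Sel^ε(E/K_∞)`: Greenberg's Lemmas 3.2 / 4.3 at the bottom layer and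
# B. D. Kim's signed `Γ`-Euler characteristic at `2` REDUCED to two displayed inputs — the local
# injectivity at `2` («`r₂⁺` injective») and the count `#ker g⁺ = 2^{ord₂ ∏ c_ℓ} · #(Sel⁺_∞)_Γ`

Route `ThetaPartnerAtTwo` (TP2), crux K4 `SignedControlAtTwo` (item stmt-BirchSwinnertonDyer-20309), line
`eulerchar`, load-bearing stub `stub_signedEulerCharTwo` (= route `ByReductionTypeAtTwo` crux 19097 line
`signed_halves_two` stub (2′)): B. D. Kim's signed `Γ`-Euler characteristic READ AT `2` on Kobayashi's
`S = Sel⁺(E/ℚ_∞)` — `Sel_{2^∞}(E/ℚ)` finite ⇒ `S^Γ` finite and `#S^Γ = u · 2^{v₂ ∏ c_ℓ} · #Sel_{2^∞}(E/ℚ) · #S_Γ`.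
Seat `prover-bsd-wall-tp2-p3` (lead, LINE mode). HONEST FRAMING: THEOREMS ONLY (no definition, no named
fact, no `sorry`), route-independent (no `Theses` import); nothing about any curve is asserted beyond the
displayed hypotheses; closes no item by itself; BSD is not proved by any of this.

This file is the `±` twin of the K3 lane's `Sprung2024/ChromaticEulerCharAssemblyProofs` (♯/♭, Lemmas 5.8 ·
5.9) and of `IwasawaEulerCharRankZeroAssemblyProofs` (classical), and of the first step of the ♭ road of
`bsd-2adic-ss-1` (`…SupersingularFlatKerGCount`): Greenberg's control diagram at `n = 0`
(LNM 1716 §3 p. 85, §4 pp. 102–104) for `Sel ↦ Sel^ε`, with `A^ε_0 := h_0⁻¹(Sel^ε(E/K_∞)) ⊆ H¹(K, E[p^∞])`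
and `ker g^ε = A^ε_0 / Sel_0` (`Sel^ε(E/K_0) = Sel_{p^∞}(E/K_0)`, Kobayashi Def. 1.1: "`E^±(F_{0,p}) = E(ℚ_p)`";
tree `Kobayashi2003.signedSelmerLayer_zero_eq`).

## What is proved

§1 (any number field `K`, prime `p`, `ℤ_p`-extension `κ`, sign `ε`; `h_0 = layerToInfty κ 0`):
* `selmerLayer_zero_le_comap_layerToInfty_signedSelmerInfty` — `Sel_0 ⊆ A^ε_0` (the control map
  `Sel_{p^∞}(E/K) → Sel^ε(E/K_∞)^Γ` exists, no hypothesis: `Sel^ε(E/K_0) = Sel(E/K_0)`);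
* `natCard_comap_layerToInfty_signedSelmerInfty` — `#A^ε_0 = #(Sel^ε_∞ ⊓ H¹(K_∞)^{Γ_K}) · #ker h_0`
  (Greenberg's Lemma 3.2 `coker h_0 = 0`, tree `ZpExtension.mem_range_resOfLe_of_conjH1_eq`);
* `natCard_signedSelmerInvariants_mul_natCard_fixedPoints` — **Lemma 4.3 for `Sel^ε`**:
  `#(Sel^ε_∞)^γ · #E[p^∞]^{Γ_K} = #Sel_{p^∞}(E/K) · #(A^ε_0/Sel_0)` when `E(K_∞)[p^∞]` is finite;
* `finite_endInvariants_conjSignedSelmerInfty_of_finite_comap`, `finite_comap_layerToInfty_signedSelmerInfty_of_finite`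
  — finiteness bookkeeping; `natCard_signedKerG_dvd_prod_natCard_localTowerKerPrimary` /
  `finite_signedKerG_of_localResOver_eq_zero` — **`#(A^ε_0/Sel_0) ∣ ∏_{w ∈ S} #𝒦_{w,0}[p^∞]`** and
  `A^ε_0/Sel_0` finite, PROVIDED the classes of `A^ε_0` satisfy the classical local condition at the
  places above `p` («`r_p^ε` injective», displayed hypothesis; Greenberg p. 104 «`ker(g) = ker(r) ∩ 𝒢`»,
  the K3 lane's generic `natCard_quotient_selmerLayer_zero_dvd_prod_natCard_localTowerKerPrimary`).
The sequel `…SignedEulerCharCount.lean` adds, over `ℚ` along the cyclotomic tower, `#(A^ε_0/Sel_0) ∣ p^{ord_p ∏ c_ℓ}`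
under «`r_p^ε` injective» and, at `p = 2`, derives the registered stub `stub_signedEulerCharTwo` from two
displayed inputs (INJ⁺@2, COUNT⁺@2). Nothing here depends on the parity of `p`.

References: [GreenbergLNM1716] R. Greenberg, LNM 1716 (1999), §3 Lemmas 3.2–3.3 (pp. 86–88), §4 Lemmas
4.2–4.7 (pp. 102–108); [BDKim2013] B. D. Kim, J. Aust. Math. Soc. 95 (2013), Thm. 1.1 / Cor. 3.15 and its
proof (pp. 199–200); [Kobayashi2003] S. Kobayashi, Invent. Math. 152 (2003), Def. 1.1, Thm. 9.3;
[Sprung2024] F. Sprung, Adv. Math. 449 (2024) §5.2 Lemmas 5.5, 5.8, 5.9 (the ♯/♭ twin, credit K3 lane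
`bsd-ssimc-k3c5-kdot-split` and `bsd-2adic-ss-1` for the templates).
-/

set_option autoImplicit false
-- the Theorems namespace of this sub repeats the summit name by design (D-0017 nested layout)
set_option linter.dupNamespace false

noncomputable section

open scoped Classical NumberField

open NumberField IsDedekindDomain

universe u

namespace Summit.BirchSwinnertonDyer.BirchSwinnertonDyer.Theorems.SignedEC

open Literature.NumberTheory.EllipticCurves Literature.NumberTheory.GaloisRepresentations
  WeierstrassCurve ZpExtension Literature.NumberTheory.EllipticCurves.Kobayashi2003
  Literature.NumberTheory.EllipticCurves.IwasawaDual Literature.NumberTheory.EllipticCurves.IwasawaAlgebra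

/-! ## §1 Greenberg's Lemmas 3.2 / 4.3 at `n = 0` for `Sel^ε(E/K_∞)` -/

section General

variable {K : Type u} [Field K] [NumberField K] (W : WeierstrassCurve K) {p : ℕ} [Fact p.Prime]
  (κ : ZpExtension K p) (ε : ℤˣ)

/-- `s ∈ Sel^ε(E/K_∞)^γ = ker(conj_γ − 1)` iff `conj_γ s = s` in `H¹(K_∞, E[p^∞])`.
[cite: Kobayashi2003, Def. 1.1 (p. 2)] -/
theorem mem_endInvariants_conjSignedSelmerInfty_iff (γ : Field.absoluteGaloisGroup K)
    (s : signedSelmerInfty W κ ε) :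
    s ∈ endInvariants (conjSignedSelmerInfty W κ ε γ - 1) ↔
      W.conjH1 p κ.kerSubgroup γ (s : W.subgroupH1 p κ.kerSubgroup) = s := by
  rw [mem_endInvariants_iff, End_sub_apply, AddMonoid.End.one_apply, sub_eq_zero,
    ← coe_conjSignedSelmerInfty_apply]
  exact ⟨fun h ↦ congrArg Subtype.val h, fun h ↦ Subtype.ext h⟩

/-- **`Sel_0 ⊆ A^ε_0 = h_0⁻¹(Sel^ε(E/K_∞))`**: the control map `Sel_{p^∞}(E/K_0) → Sel^ε(E/K_∞)` exists for
both signs with no hypothesis, because `Sel^ε(E/K_0) = Sel_{p^∞}(E/K_0)` (`signedSelmerLayer_zero_eq`: at the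
bottom layer the signed condition is the Kummer condition of all of `E(K_v)`, Kobayashi's
"`E^±(F_{0,p}) = E(ℚ_p)`") and `h_0(Sel^ε_0) ⊆ Sel^ε_∞` by definition of the direct limit.
[cite: Kobayashi2003, Def. 1.1 (p. 2)] -/
theorem selmerLayer_zero_le_comap_layerToInfty_signedSelmerInfty :
    W.selmerLayer κ 0 ≤ (signedSelmerInfty W κ ε).comap (W.layerToInfty κ 0) := by
  intro y hy
  rw [AddSubgroup.mem_comap]
  exact map_layerToInfty_signedSelmerLayer_le W κ ε 0
    ⟨y, (signedSelmerLayer_zero_eq W κ ε).symm ▸ hy, rfl⟩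

/-- `A^ε_0 = h_0⁻¹(Sel^ε(E/K_∞)) ⊆ A_0 = h_0⁻¹(Sel_{p^∞}(E/K_∞))` (`Sel^ε_∞ ≤ Sel_∞`).
[cite: Kobayashi2003, Def. 1.1 (p. 2)] [cite: GreenbergLNM1716, §3 p. 85] -/
theorem comap_layerToInfty_signedSelmerInfty_le_selmerInftyPreimage :
    (signedSelmerInfty W κ ε).comap (W.layerToInfty κ 0) ≤ W.selmerInftyPreimage κ 0 :=
  AddSubgroup.comap_mono (signedSelmerInfty_le_selmerInfty W κ ε)

/-- **`A^ε_0` finite ⟹ `Sel^ε(E/K_∞)^γ` finite** (`γ` a topological generator): a `conj_γ`-fixed class of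
`H¹(K_∞, E[p^∞])` is a restriction from `H¹(K, E[p^∞])` — Greenberg's Lemma 3.2 `coker h_0 = 0`, tree
`ZpExtension.mem_range_resOfLe_of_conjH1_eq` — so `Sel^ε_∞^γ ↪ A^ε_0` by a choice of preimages.
[cite: GreenbergLNM1716, §3 Lemma 3.2 (p. 86)] -/
theorem finite_endInvariants_conjSignedSelmerInfty_of_finite_comap
    {γ : Field.absoluteGaloisGroup K} (hγ : κ.IsTopGenerator γ)
    (hA : Finite ↥((signedSelmerInfty W κ ε).comap (W.layerToInfty κ 0))) :
    Finite ↥(endInvariants (conjSignedSelmerInfty W κ ε γ - 1)) := by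
  have hprim : ∀ m : W.geomPrimaryTorsion p, ∃ k : ℕ, p ^ k • m = 0 := fun m ↦ by
    obtain ⟨k, hk⟩ := m.2
    exact ⟨k, Subtype.ext (by rw [AddSubgroupClass.coe_nsmul, hk, ZeroMemClass.coe_zero])⟩
  have hex : ∀ s : ↥(endInvariants (conjSignedSelmerInfty W κ ε γ - 1)),
      ∃ y : ↥((signedSelmerInfty W κ ε).comap (W.layerToInfty κ 0)),
        W.layerToInfty κ 0 (y : W.subgroupH1 p (κ.layerSubgroup 0)) =
          ((s : signedSelmerInfty W κ ε) : W.subgroupH1 p κ.kerSubgroup) := by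
    intro s
    have hfix := (mem_endInvariants_conjSignedSelmerInfty_iff W κ ε γ s.1).mp s.2
    have hfix' : conjH1 κ.kerSubgroup (W.geomPrimaryTorsion p) (γ ^ p ^ 0)
        ((s : signedSelmerInfty W κ ε) : W.subgroupH1 p κ.kerSubgroup) =
          ((s : signedSelmerInfty W κ ε) : W.subgroupH1 p κ.kerSubgroup) := by
      rw [pow_zero, pow_one]; exact hfix
    obtain ⟨y, hy⟩ := ZpExtension.mem_range_resOfLe_of_conjH1_eq κ hγ 0
      (W.continuous_smul_geomPrimaryTorsion p) hprim _ hfix'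
    have hyA : y ∈ (signedSelmerInfty W κ ε).comap (W.layerToInfty κ 0) := by
      rw [AddSubgroup.mem_comap]
      change Literature.NumberTheory.EllipticCurves.resOfLe (W.geomPrimaryTorsion p)
        (κ.kerSubgroup_le_layerSubgroup 0) y ∈ signedSelmerInfty W κ ε
      rw [hy]
      exact (s : signedSelmerInfty W κ ε).2
    exact ⟨⟨y, hyA⟩, hy⟩
  choose f hf using hex
  refine Finite.of_injective f fun s t hst ↦ ?_
  have h := hf s
  rw [hst, hf t] at h
  exact Subtype.ext (Subtype.ext h.symm)

/-- **`#A^ε_0 = #(Sel^ε(E/K_∞) ⊓ H¹(K_∞)^{Γ_K}) · #ker h_0`**: `h_0` maps `A^ε_0` ONTO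
`Sel^ε_∞ ⊓ H¹(K_∞, E[p^∞])^{Γ_K}` (into: `range_layerToInfty_le_layerInvariants`; onto: Greenberg's Lemma 3.2
in the cocycle form `ZpExtension.mem_range_resOfLe_of_conjH1_eq`) with kernel `ker h_0 ⊆ A^ε_0`. An identity
of `Nat.card`s. [cite: GreenbergLNM1716, §3 Lemma 3.2 (p. 86) and §4 Lemma 4.3 (p. 103)] -/
theorem natCard_comap_layerToInfty_signedSelmerInfty :
    Nat.card ↥((signedSelmerInfty W κ ε).comap (W.layerToInfty κ 0)) =
      Nat.card ↥(signedSelmerInfty W κ ε ⊓ W.layerInvariants κ 0) *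
        Nat.card (W.layerToInfty κ 0).ker := by
  let θ : ↥((signedSelmerInfty W κ ε).comap (W.layerToInfty κ 0)) →+
      ↥(signedSelmerInfty W κ ε ⊓ W.layerInvariants κ 0) :=
    ((W.layerToInfty κ 0).comp
      ((signedSelmerInfty W κ ε).comap (W.layerToInfty κ 0)).subtype).codRestrict
      (signedSelmerInfty W κ ε ⊓ W.layerInvariants κ 0) fun y ↦
      ⟨AddSubgroup.mem_comap.mp y.2,
        W.range_layerToInfty_le_layerInvariants_holds κ 0
          ⟨(y : W.subgroupH1 p (κ.layerSubgroup 0)), rfl⟩⟩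
  have hθ : ∀ y : ↥((signedSelmerInfty W κ ε).comap (W.layerToInfty κ 0)),
      ((θ y : ↥(signedSelmerInfty W κ ε ⊓ W.layerInvariants κ 0)) : W.subgroupH1 p κ.kerSubgroup) =
        W.layerToInfty κ 0 (y : W.subgroupH1 p (κ.layerSubgroup 0)) := fun _ ↦ rfl
  have hsurj : Function.Surjective θ := by
    rintro ⟨x, hxS, hxI⟩
    obtain ⟨γ₀, hγ₀⟩ := κ.surjective (Multiplicative.ofAdd 1)
    have hγ₀' : κ.IsTopGenerator γ₀ := hγ₀
    have hfix := (W.mem_layerInvariants_iff κ 0 x).mp hxI _ (κ.pow_mem_layerSubgroup hγ₀' 0)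
    have hprim : ∀ m : W.geomPrimaryTorsion p, ∃ k : ℕ, p ^ k • m = 0 := fun m ↦ by
      obtain ⟨k, hk⟩ := m.2
      exact ⟨k, Subtype.ext (by rw [AddSubgroupClass.coe_nsmul, hk, ZeroMemClass.coe_zero])⟩
    obtain ⟨y, hy⟩ := ZpExtension.mem_range_resOfLe_of_conjH1_eq κ hγ₀' 0
      (W.continuous_smul_geomPrimaryTorsion p) hprim x hfix
    have hy' : W.layerToInfty κ 0 y = x := hy
    have hyA : y ∈ (signedSelmerInfty W κ ε).comap (W.layerToInfty κ 0) := by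
      rw [AddSubgroup.mem_comap, hy']
      exact hxS
    exact ⟨⟨y, hyA⟩, Subtype.ext ((hθ ⟨y, hyA⟩).trans hy')⟩
  have hkerle : (W.layerToInfty κ 0).ker ≤
      (signedSelmerInfty W κ ε).comap (W.layerToInfty κ 0) := fun y hy ↦ by
    rw [AddSubgroup.mem_comap, (AddMonoidHom.mem_ker).mp hy]
    exact zero_mem _
  have hker : θ.ker = ((W.layerToInfty κ 0).ker).addSubgroupOf
      ((signedSelmerInfty W κ ε).comap (W.layerToInfty κ 0)) := by
    ext y
    rw [AddMonoidHom.mem_ker, AddSubgroup.mem_addSubgroupOf, AddMonoidHom.mem_ker, ← hθ]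
    constructor
    · intro h
      rw [h]
      rfl
    · intro h
      exact Subtype.ext h
  rw [AddSubgroup.card_eq_card_quotient_mul_card_addSubgroup θ.ker,
    Nat.card_congr (QuotientAddGroup.quotientKerEquivOfSurjective θ hsurj).toEquiv, hker,
    Nat.card_congr (AddSubgroup.addSubgroupOfEquivOfLe hkerle).toEquiv]

/-- **Greenberg's Lemma 4.3 for `Sel^ε`, unconditional `Nat.card` form:
`#(Sel^ε_∞ ⊓ H¹(K_∞)^{Γ_K}) · #ker h_0 = #Sel_0 · #(A^ε_0/Sel_0)`** (both sides are `#A^ε_0`; the control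
map `Sel_0 → Sel^ε_∞` exists by `selmerLayer_zero_le_comap_layerToInfty_signedSelmerInfty`).
[cite: GreenbergLNM1716, §4 Lemma 4.3 (p. 103)] [cite: BDKim2013, proof of Cor. 3.15 (p. 199)] -/
theorem natCard_signedSelmerInvariants_mul_natCard_ker_layerToInfty :
    Nat.card ↥(signedSelmerInfty W κ ε ⊓ W.layerInvariants κ 0) * Nat.card (W.layerToInfty κ 0).ker =
      Nat.card ↥(W.selmerLayer κ 0) *
        Nat.card (↥((signedSelmerInfty W κ ε).comap (W.layerToInfty κ 0)) ⧸
          (W.selmerLayer κ 0).addSubgroupOf ((signedSelmerInfty W κ ε).comap (W.layerToInfty κ 0))) := by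
  rw [← natCard_comap_layerToInfty_signedSelmerInfty W κ ε,
    AddSubgroup.card_eq_card_quotient_mul_card_addSubgroup ((W.selmerLayer κ 0).addSubgroupOf
      ((signedSelmerInfty W κ ε).comap (W.layerToInfty κ 0))),
    Nat.card_congr (AddSubgroup.addSubgroupOfEquivOfLe
      (selmerLayer_zero_le_comap_layerToInfty_signedSelmerInfty W κ ε)).toEquiv, mul_comm]

/-- **`#(Sel^ε_∞ ⊓ H¹(K_∞)^{Γ_K}) = #(Sel^ε_∞)^γ`** for a topological generator `γ` (a class fixed by
`conj_γ` is fixed by `Γ_K`, `mem_layerInvariants_zero_of_conjH1_eq`).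
[cite: GreenbergLNM1716, §1 p. 60 and §3 p. 86] [cite: Kobayashi2003, Def. 1.1 (p. 2)] -/
theorem natCard_signedSelmerInfty_inf_layerInvariants_zero_eq {γ : Field.absoluteGaloisGroup K}
    (hγ : κ.IsTopGenerator γ) :
    Nat.card ↥(signedSelmerInfty W κ ε ⊓ W.layerInvariants κ 0) =
      Nat.card ↥(endInvariants (conjSignedSelmerInfty W κ ε γ - 1)) :=
  Nat.card_congr
    { toFun := fun x ↦ ⟨⟨(x : W.subgroupH1 p κ.kerSubgroup), x.2.1⟩,
        (mem_endInvariants_conjSignedSelmerInfty_iff W κ ε γ _).mpr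
          (W.conjH1_eq_of_mem_layerInvariants_zero κ γ x.2.2)⟩
      invFun := fun s ↦ ⟨((s : signedSelmerInfty W κ ε) : W.subgroupH1 p κ.kerSubgroup),
        ⟨(s : signedSelmerInfty W κ ε).2,
          W.mem_layerInvariants_zero_of_conjH1_eq κ hγ
            ((mem_endInvariants_conjSignedSelmerInfty_iff W κ ε γ _).mp s.2)⟩⟩
      left_inv := fun _ ↦ rfl
      right_inv := fun _ ↦ rfl }

/-- **Greenberg's Lemma 4.3 for `Sel^ε` in the printed shape:
`#(Sel^ε_∞)^γ · #E[p^∞]^{Γ_K} = #Sel_{p^∞}(E/K) · #(A^ε_0/Sel_0)`**, for every number field,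
`ℤ_p`-extension with topological generator `γ` and sign, provided `E(K_∞)[p^∞]` is finite (then
`#ker h_0 = #E[p^∞]^{Γ_K}`, tree `natCard_ker_layerToInfty_eq_natCard_fixedPoints`). This is the line
«`|Sel^±_p(E/F_∞)^Γ| ∼ |Sel_p(E/F)| ∏_{v∈Σ} |ker(g_v)|`» of B. D. Kim's proof of Cor. 3.15 before the local
kernels are counted. [cite: GreenbergLNM1716, §4 Lemma 4.3 (p. 103)] [cite: BDKim2013, proof of Cor. 3.15 (p. 199)] -/
theorem natCard_signedSelmerInvariants_mul_natCard_fixedPoints {γ : Field.absoluteGaloisGroup K}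
    (hγ : κ.IsTopGenerator γ) [Finite (FixedPoints.addSubgroup κ.kerSubgroup (W.geomPrimaryTorsion p))] :
    Nat.card ↥(endInvariants (conjSignedSelmerInfty W κ ε γ - 1)) *
        Nat.card (MulAction.fixedPoints (Field.absoluteGaloisGroup K) (W.geomPrimaryTorsion p)) =
      Nat.card ↥(W.selmerGroupPInfty p) *
        Nat.card (↥((signedSelmerInfty W κ ε).comap (W.layerToInfty κ 0)) ⧸
          (W.selmerLayer κ 0).addSubgroupOf ((signedSelmerInfty W κ ε).comap (W.layerToInfty κ 0))) := by
  rw [← natCard_signedSelmerInfty_inf_layerInvariants_zero_eq W κ ε hγ,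
    ← W.natCard_fixedBy_layerSubgroup_zero_eq κ,
    ← W.natCard_ker_layerToInfty_eq_natCard_fixedPoints κ 0, ← W.natCard_selmerLayer_zero_eq κ]
  exact natCard_signedSelmerInvariants_mul_natCard_ker_layerToInfty W κ ε

/-- **`A^ε_0` is finite when `Sel_{p^∞}(E/K)` and `A^ε_0/Sel_0` are**: `#A^ε_0 = #(A^ε_0/Sel_0) · #Sel_0`,
`Sel_0 ≃ Sel_{p^∞}(E/K)`. [cite: GreenbergLNM1716, §4 Lemma 4.3 (proof, p. 103)] -/
theorem finite_comap_layerToInfty_signedSelmerInfty_of_finite (hfin : Finite (W.selmerGroupPInfty p))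
    (hg : Finite (↥((signedSelmerInfty W κ ε).comap (W.layerToInfty κ 0)) ⧸
      (W.selmerLayer κ 0).addSubgroupOf ((signedSelmerInfty W κ ε).comap (W.layerToInfty κ 0)))) :
    Finite ↥((signedSelmerInfty W κ ε).comap (W.layerToInfty κ 0)) := by
  haveI := hg
  haveI : Finite ↥(W.selmerLayer κ 0) := W.finite_selmerLayer_zero κ hfin
  haveI : Finite ↥((W.selmerLayer κ 0).addSubgroupOf
      ((signedSelmerInfty W κ ε).comap (W.layerToInfty κ 0))) :=
    Finite.of_equiv _ (AddSubgroup.addSubgroupOfEquivOfLe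
      (selmerLayer_zero_le_comap_layerToInfty_signedSelmerInfty W κ ε)).toEquiv.symm
  refine Nat.finite_of_card_ne_zero ?_
  rw [AddSubgroup.card_eq_card_quotient_mul_card_addSubgroup ((W.selmerLayer κ 0).addSubgroupOf
    ((signedSelmerInfty W κ ε).comap (W.layerToInfty κ 0)))]
  exact mul_ne_zero Nat.card_pos.ne' Nat.card_pos.ne'

/-- **«`r_p^ε` injective» ⟹ `A^ε_0/Sel_0 = ker g^ε` is finite** (any `K`, `κ`, `ε`): if every class of
`A^ε_0` satisfies the classical local condition at the places above `p`, Greenberg's localisation at `n = 0`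
(evaluation at the finitely many bad places not above `p`, values in the finite `𝒦_{v,0}[p^∞]`, Lemma 3.3)
bounds `A^ε_0/Sel_0` — the K3 lane's `finite_quotient_selmerLayer_zero_of_localResOver_eq_zero`.
[cite: GreenbergLNM1716, §3 Lemma 3.5 (proof, p. 90) and §4 p. 104] -/
theorem finite_signedKerG_of_localResOver_eq_zero [W.IsElliptic]
    (hp : ∀ v : HeightOneSpectrum (𝓞 K), (p : 𝓞 K) ∈ v.asIdeal →
      ∀ y ∈ (signedSelmerInfty W κ ε).comap (W.layerToInfty κ 0),
        W.localResOver p (κ.layerSubgroup 0) (v.adicCompletion K) y = 0) :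
    Finite (↥((signedSelmerInfty W κ ε).comap (W.layerToInfty κ 0)) ⧸
      (W.selmerLayer κ 0).addSubgroupOf ((signedSelmerInfty W κ ε).comap (W.layerToInfty κ 0))) :=
  W.finite_quotient_selmerLayer_zero_of_localResOver_eq_zero κ _
    (comap_layerToInfty_signedSelmerInfty_le_selmerInftyPreimage W κ ε) hp

/-- **«`r_p^ε` injective» ⟹ `#(A^ε_0/Sel_0) ∣ ∏_{v ∈ S} #𝒦_{v,0}[p^∞]`** for every finite set `S` of places
outside which every place not above `p` is good (Greenberg p. 104 «`ker(g) = ker(r) ∩ 𝒢_E^Σ(F)`»,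
`|ker(r)| = ∏_v |ker(r_v)|`; the K3 lane's generic
`natCard_quotient_selmerLayer_zero_dvd_prod_natCard_localTowerKerPrimary` applied to `A' = A^ε_0`).
[cite: GreenbergLNM1716, §4 p. 104 and §3 Lemma 3.3 (pp. 86–88)] -/
theorem natCard_signedKerG_dvd_prod_natCard_localTowerKerPrimary [W.IsElliptic]
    (hp : ∀ v : HeightOneSpectrum (𝓞 K), (p : 𝓞 K) ∈ v.asIdeal →
      ∀ y ∈ (signedSelmerInfty W κ ε).comap (W.layerToInfty κ 0),
        W.localResOver p (κ.layerSubgroup 0) (v.adicCompletion K) y = 0)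
    (S : Finset (HeightOneSpectrum (𝓞 K)))
    (hS : ∀ v : HeightOneSpectrum (𝓞 K), v ∉ S → (p : 𝓞 K) ∉ v.asIdeal → W.HasGoodReductionAt v) :
    Nat.card (↥((signedSelmerInfty W κ ε).comap (W.layerToInfty κ 0)) ⧸
      (W.selmerLayer κ 0).addSubgroupOf ((signedSelmerInfty W κ ε).comap (W.layerToInfty κ 0))) ∣
      ∏ v ∈ S, Nat.card (W.localTowerKerPrimary κ (v.adicCompletion K) 0) :=
  W.natCard_quotient_selmerLayer_zero_dvd_prod_natCard_localTowerKerPrimary κ _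
    (comap_layerToInfty_signedSelmerInfty_le_selmerInftyPreimage W κ ε) hp S hS

end General

end Summit.BirchSwinnertonDyer.BirchSwinnertonDyer.Theorems.SignedEC

end
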